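import Summits.Ventures.DiscreteObjects.PP12.OrderThirteenCollineation

/-!
# PP(12), order-13 cell: the ORBIT MATRIX of lift data and its equations (kernel)
Framing: lottery ticket; floor = certified bounds/negative ranges.

Cell pub-namedobj (venture DiscreteObjects), target (M), designs gen 18. For lift data `D : LiftData N p` (`OrderThirteenCollineation`) the orbit matrix is
`om D s t = |E_{s,t}|` (`LiftData.cell`, `LiftData.om`). From `LiftData.Valid` (all line pairs meet exactly once) the classical orbit-matrix equations follow
by counting (FAMILY-B1P-PLUS §2 / designs g3 `p13om.c`, there on paper): every row sums to `p − 1` (`om_row_sum`, from (M·U)); the ordered pairs of distinct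
elements inside the cells of a row are in bijection with the non-zero residues, so `Σ_t m_{s,t}(m_{s,t} − 1) = p − 1` (`om_internal_sum`, from (U·U)); for two
rows the pairs in equal columns are in bijection with the non-zero residues, so `Σ_t m_{s,t} m_{s',t} = p − 1` (`om_cross_sum`, from (U·U′)); and every column
sums to `p − 1` (`om_col_sum`: columns are disjoint by (U·U′), and the total is `N (p − 1)`). For `N = 11`, `p = 13` these are the equations whose doubly-lexical
solutions designs g3 enumerated (836, 38 classes); with `OrderThirteenRelabel` and `DoublyLexical` a kernel certificate may assume the orbit matrix doubly
lexical. Nothing asserts any census statement. No `sorry`, no new axioms.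
-/

namespace Summit.Ventures.DiscreteObjects.PP12

namespace LiftData

open Finset

variable {N p : ℕ}

/-- the cell `E_{s,t}` of lift data, as a finset of residues -/
def cell (D : LiftData N p) (s t : Fin N) : Finset (Fin p) := univ.filter fun x => D.mem s t x = true

/-- the orbit matrix: `om D s t = |E_{s,t}|` -/
def om (D : LiftData N p) (s t : Fin N) : ℕ := (D.cell s t).card

/-- membership in a cell -/
@[simp] theorem mem_cell (D : LiftData N p) (s t : Fin N) (x : Fin p) : x ∈ D.cell s t ↔ D.mem s t x = true := by
  simp [cell]

/-- the ordered pairs of distinct elements of the cells of row `s`, tagged by the column -/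
def intPairs (D : LiftData N p) (s : Fin N) : Finset (Fin N × Fin p × Fin p) :=
  univ.filter fun q => q.2.1 ≠ q.2.2 ∧ D.mem s q.1 q.2.1 = true ∧ D.mem s q.1 q.2.2 = true

/-- the pairs (element of `E_{s,t}`, element of `E_{s',t}`), tagged by the column -/
def crossPairs (D : LiftData N p) (s s' : Fin N) : Finset (Fin N × Fin p × Fin p) :=
  univ.filter fun q => D.mem s q.1 q.2.1 = true ∧ D.mem s' q.1 q.2.2 = true

variable [NeZero p]

/-- the number of non-zero residues -/
theorem card_nonzero : (univ.filter fun x : Fin p => x ≠ 0).card = p - 1 := by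
  rw [Finset.filter_ne' univ (0 : Fin p), Finset.card_erase_of_mem (mem_univ _), Finset.card_univ, Fintype.card_fin]

/-! ### rows -/

/-- (M·U): the cells of a row are pairwise disjoint -/
theorem cell_disjoint_row (D : LiftData N p) {s : Fin N} (h : D.RowPartition s) {t t' : Fin N} (htt : t ≠ t') :
    Disjoint (D.cell s t) (D.cell s t') := by
  rw [Finset.disjoint_left]
  intro x hx hx'
  rw [mem_cell] at hx hx'
  have hx0 : x ≠ 0 := by rintro rfl; rw [h.1 t] at hx; exact Bool.false_ne_true hx
  obtain ⟨u, -, huniq⟩ := h.2 x hx0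
  exact htt ((huniq t hx).trans (huniq t' hx').symm)

/-- (M·U): the cells of a row cover exactly the non-zero residues -/
theorem biUnion_cell_row (D : LiftData N p) {s : Fin N} (h : D.RowPartition s) :
    univ.biUnion (fun t => D.cell s t) = univ.filter fun x : Fin p => x ≠ 0 := by
  ext x
  simp only [mem_biUnion, mem_univ, true_and, mem_cell, mem_filter]
  constructor
  · rintro ⟨t, ht⟩ rfl
    rw [h.1 t] at ht; exact Bool.false_ne_true ht
  · intro hx
    obtain ⟨t, ht, -⟩ := h.2 x hx
    exact ⟨t, ht⟩

/-- **row sums**: `Σ_t m_{s,t} = p − 1` -/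
theorem om_row_sum (D : LiftData N p) {s : Fin N} (h : D.RowPartition s) : ∑ t, D.om s t = p - 1 := by
  unfold om
  rw [← card_biUnion (fun t _ t' _ htt => D.cell_disjoint_row h htt), D.biUnion_cell_row h, card_nonzero]

/-! ### internal differences -/

/-- (U·U): the difference map is a bijection from the internal pairs onto the non-zero residues -/
theorem card_intPairs (D : LiftData N p) {s : Fin N} (h : D.Internal s) : (D.intPairs s).card = p - 1 := by
  rw [← card_nonzero]
  apply Finset.card_bij (fun q _ => q.2.1 - q.2.2)
  · intro q hq
    simp only [intPairs, mem_filter, mem_univ, true_and] at hq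
    simp only [mem_filter, mem_univ, true_and]
    exact fun e => hq.1 (sub_eq_zero.1 e)
  · intro q hq q' hq' e
    simp only [intPairs, mem_filter, mem_univ, true_and] at hq hq'
    have hδ : q.2.1 - q.2.2 ≠ 0 := fun e0 => hq.1 (sub_eq_zero.1 e0)
    obtain ⟨t, x, -, -, huniq⟩ := h (q.2.1 - q.2.2) hδ
    have e1 := huniq q.1 q.2.1 hq.2.1 (by rw [sub_sub_cancel]; exact hq.2.2)
    have e2 := huniq q'.1 q'.2.1 hq'.2.1 (by rw [e, sub_sub_cancel]; exact hq'.2.2)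
    have hfst : q.1 = q'.1 := e1.1.trans e2.1.symm
    have hx : q.2.1 = q'.2.1 := e1.2.trans e2.2.symm
    have hy : q.2.2 = q'.2.2 := by
      have := congrArg (fun d => q.2.1 - d) e
      simp only [sub_sub_cancel] at this
      rw [this, hx, sub_sub_cancel]
    exact Prod.ext hfst (Prod.ext hx hy)
  · intro δ hδ
    simp only [mem_filter, mem_univ, true_and] at hδ
    obtain ⟨t, x, h1, h2, -⟩ := h δ hδ
    refine ⟨(t, x, x - δ), ?_, by simp⟩
    simp only [intPairs, mem_filter, mem_univ, true_and]
    exact ⟨fun e => hδ (by have := congrArg (fun y => x - y) e; simpa using this.symm), h1, h2⟩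

omit [NeZero p] in
/-- the internal pairs counted cell by cell: `Σ_t m_{s,t}(m_{s,t} − 1)` -/
theorem card_intPairs_eq_sum (D : LiftData N p) (s : Fin N) : (D.intPairs s).card = ∑ t, D.om s t * (D.om s t - 1) := by
  rw [card_eq_sum_card_fiberwise (f := fun q : Fin N × Fin p × Fin p => q.1) (t := univ) (fun _ _ => mem_univ _)]
  refine Finset.sum_congr rfl fun t _ => ?_
  have e : (D.intPairs s).filter (fun q => q.1 = t) = ((D.cell s t).offDiag).image fun xy => (t, xy) := by
    ext q
    simp only [intPairs, mem_filter, mem_univ, true_and, mem_image, mem_offDiag, mem_cell]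
    constructor
    · rintro ⟨⟨hne, h1, h2⟩, rfl⟩
      exact ⟨(q.2.1, q.2.2), ⟨h1, h2, hne⟩, rfl⟩
    · rintro ⟨xy, ⟨h1, h2, hne⟩, rfl⟩
      exact ⟨⟨hne, h1, h2⟩, rfl⟩
  rw [e, card_image_of_injective _ (fun a b hab => by simpa using hab), offDiag_card]
  unfold om
  rw [Nat.mul_sub_one]

/-- **internal differences**: `Σ_t m_{s,t}(m_{s,t} − 1) = p − 1` -/
theorem om_internal_sum (D : LiftData N p) {s : Fin N} (h : D.Internal s) : ∑ t, D.om s t * (D.om s t - 1) = p - 1 := by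
  rw [← card_intPairs_eq_sum, D.card_intPairs h]

/-! ### cross differences -/

/-- (U·U′): the difference map is a bijection from the cross pairs onto the non-zero residues -/
theorem card_crossPairs (D : LiftData N p) {s s' : Fin N} (h : D.Cross s s') : (D.crossPairs s s').card = p - 1 := by
  rw [← card_nonzero]
  have hne : ∀ q ∈ D.crossPairs s s', q.2.1 - q.2.2 ≠ 0 := by
    intro q hq e
    simp only [crossPairs, mem_filter, mem_univ, true_and] at hq
    have exy : q.2.1 = q.2.2 := sub_eq_zero.1 e
    exact h.1 q.1 q.2.1 ⟨hq.1, by rw [exy]; exact hq.2⟩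
  apply Finset.card_bij (fun q _ => q.2.1 - q.2.2)
  · intro q hq
    simp only [mem_filter, mem_univ, true_and]
    exact hne q hq
  · intro q hq q' hq' e
    have hδ := hne q hq
    simp only [crossPairs, mem_filter, mem_univ, true_and] at hq hq'
    obtain ⟨t, x, -, -, huniq⟩ := h.2 (q.2.1 - q.2.2) hδ
    have e1 := huniq q.1 q.2.1 hq.1 (by rw [sub_sub_cancel]; exact hq.2)
    have e2 := huniq q'.1 q'.2.1 hq'.1 (by rw [e, sub_sub_cancel]; exact hq'.2)
    have hfst : q.1 = q'.1 := e1.1.trans e2.1.symm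
    have hx : q.2.1 = q'.2.1 := e1.2.trans e2.2.symm
    have hy : q.2.2 = q'.2.2 := by
      have := congrArg (fun d => q.2.1 - d) e
      simp only [sub_sub_cancel] at this
      rw [this, hx, sub_sub_cancel]
    exact Prod.ext hfst (Prod.ext hx hy)
  · intro δ hδ
    simp only [mem_filter, mem_univ, true_and] at hδ
    obtain ⟨t, x, h1, h2, -⟩ := h.2 δ hδ
    refine ⟨(t, x, x - δ), ?_, by simp⟩
    simp only [crossPairs, mem_filter, mem_univ, true_and]
    exact ⟨h1, h2⟩

omit [NeZero p] in
/-- the cross pairs counted column by column: `Σ_t m_{s,t} m_{s',t}` -/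
theorem card_crossPairs_eq_sum (D : LiftData N p) (s s' : Fin N) : (D.crossPairs s s').card = ∑ t, D.om s t * D.om s' t := by
  rw [card_eq_sum_card_fiberwise (f := fun q : Fin N × Fin p × Fin p => q.1) (t := univ) (fun _ _ => mem_univ _)]
  refine Finset.sum_congr rfl fun t _ => ?_
  have e : (D.crossPairs s s').filter (fun q => q.1 = t) = (D.cell s t ×ˢ D.cell s' t).image fun xy => (t, xy) := by
    ext q
    simp only [crossPairs, mem_filter, mem_univ, true_and, mem_image, mem_product, mem_cell]
    constructor
    · rintro ⟨⟨h1, h2⟩, rfl⟩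
      exact ⟨(q.2.1, q.2.2), ⟨h1, h2⟩, rfl⟩
    · rintro ⟨xy, ⟨h1, h2⟩, rfl⟩
      exact ⟨⟨h1, h2⟩, rfl⟩
  rw [e, card_image_of_injective _ (fun a b hab => by simpa using hab), card_product]
  rfl

/-- **cross differences**: `Σ_t m_{s,t} m_{s',t} = p − 1` for `s ≠ s'` -/
theorem om_cross_sum (D : LiftData N p) {s s' : Fin N} (h : D.Cross s s') : ∑ t, D.om s t * D.om s' t = p - 1 := by
  rw [← card_crossPairs_eq_sum, D.card_crossPairs h]

/-! ### columns -/

/-- (U·U′)+(M·U): the cells of a column are pairwise disjoint and avoid `0`, so a column sums to at most `p − 1` -/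
theorem om_col_sum_le (D : LiftData N p) (hV : D.Valid) (t : Fin N) : ∑ s, D.om s t ≤ p - 1 := by
  unfold om
  rw [← card_biUnion]
  · rw [← card_nonzero]
    apply card_le_card
    intro x hx
    simp only [mem_biUnion, mem_univ, true_and, mem_cell] at hx
    obtain ⟨s, hs⟩ := hx
    simp only [mem_filter, mem_univ, true_and]
    rintro rfl
    rw [(hV.1 s).1.1 t] at hs
    exact Bool.false_ne_true hs
  · intro s _ s' _ hss
    show Disjoint (D.cell s t) (D.cell s' t)
    rw [Finset.disjoint_left]
    intro x hx hx'
    rw [mem_cell] at hx hx'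
    exact (hV.2 s s' hss).1 t x ⟨hx, hx'⟩

/-- **column sums**: `Σ_s m_{s,t} = p − 1` (the total over the matrix is `N (p − 1)` by the row sums) -/
theorem om_col_sum (D : LiftData N p) (hV : D.Valid) (t : Fin N) : ∑ s, D.om s t = p - 1 := by
  by_contra hne
  have hlt : ∑ s, D.om s t < p - 1 := lt_of_le_of_ne (D.om_col_sum_le hV t) hne
  have htot : ∑ t', ∑ s, D.om s t' = ∑ t' : Fin N, (p - 1) := by
    rw [Finset.sum_comm]
    exact Finset.sum_congr rfl fun s _ => D.om_row_sum (hV.1 s).1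
  have hlt' : ∑ t', ∑ s, D.om s t' < ∑ t' : Fin N, (p - 1) :=
    Finset.sum_lt_sum (fun t' _ => D.om_col_sum_le hV t') ⟨t, mem_univ _, hlt⟩
  exact absurd htot (ne_of_lt hlt')

/-- **the orbit-matrix equations of valid lift data** (what an orbit-matrix enumeration solves), collected -/
theorem om_equations (D : LiftData N p) (hV : D.Valid) :
    (∀ s, ∑ t, D.om s t = p - 1) ∧ (∀ s, ∑ t, D.om s t * (D.om s t - 1) = p - 1) ∧
      (∀ s s', s ≠ s' → ∑ t, D.om s t * D.om s' t = p - 1) ∧ (∀ t, ∑ s, D.om s t = p - 1) :=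
  ⟨fun s => D.om_row_sum (hV.1 s).1, fun s => D.om_internal_sum (hV.1 s).2, fun s s' hss => D.om_cross_sum (hV.2 s s' hss),
    fun t => D.om_col_sum hV t⟩

end LiftData

end Summit.Ventures.DiscreteObjects.PP12
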